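import Literature.NumberTheory.EllipticCurves.ShaRestrictionIndex
import Literature.NumberTheory.EllipticCurves.SelmerCorankAssembly
import Literature.NumberTheory.EllipticCurves.SelmerGaloisAction
import Literature.NumberTheory.EllipticCurves.SelmerUnramified
import Mathlib.GroupTheory.IndexNormal
import HarnessLib

/-!
# Restriction `Sel_{p^∞}(E/K) → Sel_{p^∞}(E_L/L)` and the subgroup model of `H¹(L, E_L[p^∞])`

For a Weierstrass curve `W` (an elliptic curve `E`) over a field `K`, a `K`-field `L` and a prime
`p`, on the tree's model of Galois cohomology (`WeierstrassCurve.galH1Primary`,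
`WeierstrassCurve.selmerGroupPInfty` of file `Selmer`; restriction machinery of `Sha`,
`ShaRestriction`):

* `primaryBaseChangeMap W L p : E[p^∞](K̄) → E_L[p^∞](L̄)` — the chosen-embedding map on points
  (`pointsMap`) followed by the identification of coefficient modules
  (`localPointsEquivGeomPoints`), on `p`-primary parts; equivariant along `resGal L : Γ_L → Γ_K`;
* `resPrimary W L p : H¹(K, E[p^∞]) → H¹(L, E_L[p^∞])` — restriction; it commutes with
  `H¹(·, E[p^∞]) → H¹(·, E)` (`primaryH1ToH1_resPrimary`) and therefore **maps
  `Sel_{p^∞}(E/K)` into `Sel_{p^∞}(E_L/L)`** (`resPrimary_mem_selmerGroupPInfty`; the Selmer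
  groups being the preimages of `Ш`, `selmerGroupPInfty_eq_comap_sha`, and restriction mapping
  `Ш(E/K)` into `Ш(E_L/L)`, `resBaseChange_mem_sha`) — the map of Dokchitser–Dokchitser, Ann.
  of Math. 172 (2010), proof of Lemma 4.14 ("the restriction map from `H¹(K, E[pⁿ])` to
  `H¹(F, E[pⁿ])^G` induces a map `Sel_{pⁿ}(E/K) → Sel_{pⁿ}(E/F)^G`");
* for `L/K` algebraic, the **subgroup model**: `resGal L` is injective with image the subgroup
  `galRange L ≤ Γ_K`, `primaryBaseChangeMap` is bijective, and
  `modelIso W L p : H¹(L, E_L[p^∞]) ≃ H¹(galRange L, E[p^∞])` (cohomology of the subgroup with the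
  restricted coefficients, `Literature.NumberTheory.EllipticCurves.subgroupH1`) identifies
  `resPrimary` with the plain restriction to the subgroup (`modelIso_resPrimary`);
* for number fields with `L/K` Galois of degree `2`: `galRange L` is open, of index `2`, and for
  the non-trivial `σ₀ ∈ Gal(L/K)` the transported lift `liftToAbsGal L σ₀ ∈ Γ_K` represents the
  non-trivial coset (`xor_galRange`: `Γ_K = galRange L ⊔ galRange L · liftToAbsGal L σ₀`).

Everything here is proved; this is bookkeeping for the proof of
`Literature.NumberTheory.EllipticCurves.selmerCorank_baseChange_quadratic`.

## References

* T. Dokchitser, V. Dokchitser, *On the Birch–Swinnerton-Dyer quotients modulo squares*, Ann. of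
  Math. 172 (2010), Lemma 4.14 (proof). [DokchitserDokchitserAnnals2010]
* J.-P. Serre, *Galois Cohomology* (1997), I.§2.4, II.§1.1. [SerreGaloisCohomology1997]
-/

noncomputable section

open scoped Classical

universe u

namespace Literature.NumberTheory.EllipticCurves

open GaloisRepresentations WeierstrassCurve

/-! ## `E[p^∞](K̄) → E_L[p^∞](L̄)` and restriction on `H¹(·, E[p^∞])` -/

section PrimaryPoints

variable {K : Type u} [Field K] (W : WeierstrassCurve K) (L : Type u) [Field L] [Algebra K L]
  (p : ℕ)

/-- A homomorphism maps `p`-primary elements to `p`-primary elements. [folklore] -/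
theorem map_mem_primaryComponent {A B : Type*} [AddCommGroup A] [AddCommGroup B] (f : A →+ B)
    {p : ℕ} {a : A} (ha : a ∈ AddCommGroup.primaryComponent A p) :
    f a ∈ AddCommGroup.primaryComponent B p := by
  obtain ⟨k, hk⟩ := AddCommGroup.mem_primaryComponent.mp ha
  exact AddCommGroup.mem_primaryComponent.mpr ⟨k, by rw [← map_nsmul, hk, map_zero]⟩

/-- The map `E[p^∞](K̄) → E_L[p^∞](L̄)`: the points map `E(K̄) → E(L̄)` along the chosen embedding
`K̄ → L̄` (`pointsMap`) followed by the identification `E(L̄) = E_L(L̄)`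
(`localPointsEquivGeomPoints`), restricted to `p`-primary parts.
Serre, *Galois Cohomology*, I.§2.4, II.§1.1. [folklore] -/
def primaryBaseChangeMap : geomPrimaryTorsion W p →+ geomPrimaryTorsion (W.baseChange L) p :=
  ((((localPointsEquivGeomPoints W L : localPoints W L ≃+ geomPoints (W.baseChange L)) :
      localPoints W L →+ geomPoints (W.baseChange L)).comp
        ((pointsMap W L).comp (geomPrimaryTorsion W p).subtype)).codRestrict
    (geomPrimaryTorsion (W.baseChange L) p)) fun P ↦
      map_mem_primaryComponent
        (((localPointsEquivGeomPoints W L : localPoints W L ≃+ geomPoints (W.baseChange L)) :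
          localPoints W L →+ geomPoints (W.baseChange L)).comp (pointsMap W L)) P.2

/-- Values of `primaryBaseChangeMap`. [folklore] -/
@[simp]
theorem coe_primaryBaseChangeMap (P : geomPrimaryTorsion W p) :
    (primaryBaseChangeMap W L p P : geomPoints (W.baseChange L)) =
      localPointsEquivGeomPoints W L (pointsMap W L P) :=
  rfl

/-- `primaryBaseChangeMap` is equivariant along `resGal L : Γ_L → Γ_K`. [folklore] -/
theorem primaryBaseChangeMap_smul (σ : Field.absoluteGaloisGroup L) (P : geomPrimaryTorsion W p) :
    primaryBaseChangeMap W L p (resGal (K := K) L σ • P) = σ • primaryBaseChangeMap W L p P := by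
  apply Subtype.ext
  rw [coe_primaryBaseChangeMap, primaryComponent.coe_smul, primaryComponent.coe_smul, pointsMap_smul,
    localPointsEquivGeomPoints_smul, coe_primaryBaseChangeMap]

/-- `primaryBaseChangeMap` is injective. [folklore] -/
theorem primaryBaseChangeMap_injective : Function.Injective (primaryBaseChangeMap W L p) := by
  intro P Q h
  have h' := congrArg (fun x : geomPrimaryTorsion (W.baseChange L) p ↦
    (x : geomPoints (W.baseChange L))) h
  simp only [coe_primaryBaseChangeMap, EmbeddingLike.apply_eq_iff_eq] at h'
  exact Subtype.ext (pointsMapOfEmb_injective W _ h')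

/-- **Restriction `H¹(K, E[p^∞]) → H¹(L, E_L[p^∞])`** along the compatible pair
`(resGal L, primaryBaseChangeMap)`. Serre, *Galois Cohomology*, I.§2.4; Dokchitser–Dokchitser 2010,
proof of Lemma 4.14. [folklore] -/
def resPrimary : galH1Primary W p →+ galH1Primary (W.baseChange L) p :=
  resH1Hom (resGal (K := K) L) (primaryBaseChangeMap W L p) (primaryBaseChangeMap_smul W L p)

/-- **Restriction commutes with `H¹(·, E[p^∞]) → H¹(·, E)`**:
`(E_L[p^∞] ↪ E_L)_* ∘ res = res ∘ (E[p^∞] ↪ E)_*`, both being the map of the pair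
`(resGal L, E[p^∞] ↪ E(K̄) → E(L̄) = E_L(L̄))`. Serre, *Galois Cohomology*, I.§2.4. [folklore] -/
theorem primaryH1ToH1_resPrimary (x : galH1Primary W p) :
    primaryH1ToH1 (W.baseChange L) p (resPrimary W L p x) =
      resBaseChange W L (primaryH1ToH1 W p x) := by
  rw [primaryH1ToH1, resPrimary, resH1Hom_resH1Hom, resBaseChange, AddMonoidHom.comp_apply,
    AddEquiv.coe_toAddMonoidHom, h1Equiv_apply, primaryH1ToH1]
  change _ = resH1Hom _ _ _ (resH1Hom (resGal (K := K) L) (pointsMap W L) (pointsMap_smul W L)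
    (resH1Hom _ _ _ x))
  rw [resH1Hom_resH1Hom, resH1Hom_resH1Hom]
  exact congrFun (congrArg DFunLike.coe (resH1Hom_congr (by ext; rfl) (by ext; rfl) _ _)) x

variable [NumberField K] [NumberField L]

/-- **Restriction maps `Sel_{p^∞}(E/K)` into `Sel_{p^∞}(E_L/L)`**: the Selmer groups are the
preimages of `Ш` under `H¹(·, E[p^∞]) → H¹(·, E)` (`selmerGroupPInfty_eq_comap_sha`), restriction
commutes with these maps (`primaryH1ToH1_resPrimary`) and maps `Ш(E/K)` into `Ш(E_L/L)`
(`resBaseChange_mem_sha`). Dokchitser–Dokchitser 2010, proof of Lemma 4.14 (the map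
`Sel(E/K) → Sel(E/F)`). [cite: DokchitserDokchitserAnnals2010, Lemma 4.14 (proof)] -/
theorem resPrimary_mem_selmerGroupPInfty {x : galH1Primary W p} (hx : x ∈ selmerGroupPInfty W p) :
    resPrimary W L p x ∈ selmerGroupPInfty (W.baseChange L) p := by
  rw [selmerGroupPInfty_eq_comap_sha, AddSubgroup.mem_comap] at hx ⊢
  rw [primaryH1ToH1_resPrimary]
  exact resBaseChange_mem_sha W L hx

end PrimaryPoints

/-! ## The subgroup model of `Γ_L` and of `H¹(L, E_L[p^∞])` for `L/K` algebraic -/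

section Model

variable {K : Type u} [Field K] (L : Type u) [Field L] [Algebra K L]

/-- The image of `resGal L : Γ_L → Γ_K`, a subgroup of `Γ_K` (for `L/K` algebraic: the absolute
Galois group of the copy of `L` inside `K̄` cut out by the chosen embedding).
Serre, *Galois Cohomology*, II.§1.1. [folklore] -/
def galRange : Subgroup (Field.absoluteGaloisGroup K) :=
  ((resGal (K := K) L : Field.absoluteGaloisGroup L →ₜ* Field.absoluteGaloisGroup K) :
    Field.absoluteGaloisGroup L →* Field.absoluteGaloisGroup K).range

/-- Membership in `galRange`. [folklore] -/
theorem mem_galRange_iff (g : Field.absoluteGaloisGroup K) :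
    g ∈ galRange (K := K) L ↔ ∃ σ : Field.absoluteGaloisGroup L, resGal (K := K) L σ = g :=
  Iff.rfl

variable [Algebra.IsAlgebraic K L]

/-- The defining identity of `resGal L σ` through the isomorphism `e : K̄ ≃ L̄` given by the
chosen embedding (`algEquivOfEmb`): `e (resGal L σ z) = σ (e z)`. [folklore] -/
theorem algEquivOfEmb_resGal_apply (σ : Field.absoluteGaloisGroup L) (z : AlgebraicClosure K) :
    algEquivOfEmb L (closureEmb (K := K) L)
        ((show AlgebraicClosure K ≃ₐ[K] AlgebraicClosure K from resGal (K := K) L σ) z) =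
      (show AlgebraicClosure L ≃ₐ[L] AlgebraicClosure L from σ)
        (algEquivOfEmb L (closureEmb (K := K) L) z) :=
  apply_resGalAuxOfEmb_apply (closureEmb (K := K) L) σ z

/-- For `L/K` algebraic, `resGal L : Γ_L → Γ_K` is injective (the chosen embedding `K̄ → L̄` is
then an isomorphism). Serre, *Galois Cohomology*, II.§1.1. [folklore] -/
theorem resGal_injective : Function.Injective (resGal (K := K) L) := by
  intro σ τ h
  have key : ∀ z : AlgebraicClosure L,
      (show AlgebraicClosure L ≃ₐ[L] AlgebraicClosure L from σ) z =
        (show AlgebraicClosure L ≃ₐ[L] AlgebraicClosure L from τ) z := fun z ↦ by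
    obtain ⟨x, rfl⟩ := (algEquivOfEmb L (closureEmb (K := K) L)).surjective z
    rw [← algEquivOfEmb_resGal_apply, ← algEquivOfEmb_resGal_apply, h]
  exact AlgEquiv.ext key

/-- `resGal L` with values in its image, a continuous monoid homomorphism `Γ_L → galRange L`.
[folklore] -/
def resGalToRange : Field.absoluteGaloisGroup L →ₜ* galRange (K := K) L where
  toMonoidHom := ((resGal (K := K) L : Field.absoluteGaloisGroup L →ₜ* Field.absoluteGaloisGroup K) :
    Field.absoluteGaloisGroup L →* Field.absoluteGaloisGroup K).rangeRestrict
  continuous_toFun := (resGal (K := K) L).continuous_toFun.subtype_mk _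

omit [Algebra.IsAlgebraic K L] in
/-- Values of `resGalToRange`. [folklore] -/
@[simp]
theorem coe_resGalToRange (σ : Field.absoluteGaloisGroup L) :
    ((resGalToRange (K := K) L σ : galRange (K := K) L) : Field.absoluteGaloisGroup K) =
      resGal (K := K) L σ :=
  rfl

/-- `resGalToRange` is bijective. [folklore] -/
theorem resGalToRange_bijective : Function.Bijective (resGalToRange (K := K) L) := by
  refine ⟨fun σ τ h ↦ resGal_injective L (congrArg Subtype.val h), ?_⟩
  rintro ⟨_, σ, rfl⟩
  exact ⟨σ, rfl⟩

variable (W : WeierstrassCurve K) (p : ℕ)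

/-- For `L/K` algebraic, `primaryBaseChangeMap : E[p^∞](K̄) → E_L[p^∞](L̄)` is bijective
(`pointsMapOfEmb_bijective`). [folklore] -/
theorem primaryBaseChangeMap_bijective : Function.Bijective (primaryBaseChangeMap W L p) := by
  refine ⟨primaryBaseChangeMap_injective W L p, fun Q ↦ ?_⟩
  obtain ⟨P, hP⟩ := (pointsMapOfEmb_bijective L W (closureEmb (K := K) L)).2
    ((localPointsEquivGeomPoints W L).symm (Q : geomPoints (W.baseChange L)))
  have hPmem : P ∈ geomPrimaryTorsion W p := by
    obtain ⟨k, hk⟩ := AddCommGroup.mem_primaryComponent.mp Q.2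
    refine AddCommGroup.mem_primaryComponent.mpr ⟨k, pointsMapOfEmb_injective W (closureEmb L) ?_⟩
    rw [map_nsmul, map_zero, hP, ← map_nsmul, hk, map_zero]
  refine ⟨⟨P, hPmem⟩, Subtype.ext ?_⟩
  rw [coe_primaryBaseChangeMap]
  change localPointsEquivGeomPoints W L (pointsMapOfEmb W (closureEmb L) P) = Q
  rw [hP, AddEquiv.apply_symm_apply]

/-- The coefficient isomorphism `E[p^∞](K̄) ≃ E_L[p^∞](L̄)` for `L/K` algebraic. [folklore] -/
def primaryBaseChangeEquiv : geomPrimaryTorsion W p ≃+ geomPrimaryTorsion (W.baseChange L) p :=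
  AddEquiv.ofBijective _ (primaryBaseChangeMap_bijective L W p)

/-- `primaryBaseChangeEquiv` is `primaryBaseChangeMap`. [folklore] -/
@[simp]
theorem primaryBaseChangeEquiv_apply (P : geomPrimaryTorsion W p) :
    primaryBaseChangeEquiv L W p P = primaryBaseChangeMap W L p P :=
  rfl

/-- Compatibility of the pair `(resGalToRange, primaryBaseChangeEquiv)`. [folklore] -/
theorem primaryBaseChangeEquiv_smul (σ : Field.absoluteGaloisGroup L) (P : geomPrimaryTorsion W p) :
    primaryBaseChangeEquiv L W p (resGalToRange (K := K) L σ • P) = σ • primaryBaseChangeEquiv L W p P :=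
  primaryBaseChangeMap_smul W L p σ P

variable [PerfectField L]

/-- The inverse `galRange L → Γ_L` of `resGalToRange`, a continuous monoid homomorphism (a
continuous bijection from the compact `Γ_L` to the Hausdorff `galRange L` is a homeomorphism).
Serre, *Galois Cohomology*, II.§1.1. [folklore] -/
def rangeToResGal : galRange (K := K) L →ₜ* Field.absoluteGaloisGroup L where
  toMonoidHom := (MulEquiv.ofBijective _ (resGalToRange_bijective (K := K) L)).symm.toMonoidHom
  continuous_toFun := by
    haveI : CompactSpace (Field.absoluteGaloisGroup L) := compactSpace_absoluteGaloisGroup L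
    let e : Field.absoluteGaloisGroup L ≃ galRange (K := K) L :=
      Equiv.ofBijective _ (resGalToRange_bijective (K := K) L)
    have he : Continuous e := (resGalToRange (K := K) L).continuous_toFun
    exact (he.homeoOfEquivCompactToT2 (f := e)).symm.continuous

/-- `rangeToResGal ∘ resGalToRange = id`. [folklore] -/
@[simp]
theorem rangeToResGal_resGalToRange (σ : Field.absoluteGaloisGroup L) :
    rangeToResGal (K := K) L (resGalToRange (K := K) L σ) = σ :=
  (MulEquiv.ofBijective _ (resGalToRange_bijective (K := K) L)).symm_apply_apply σ

/-- `resGalToRange ∘ rangeToResGal = id`. [folklore] -/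
@[simp]
theorem resGalToRange_rangeToResGal (n : galRange (K := K) L) :
    resGalToRange (K := K) L (rangeToResGal (K := K) L n) = n :=
  (MulEquiv.ofBijective _ (resGalToRange_bijective (K := K) L)).apply_symm_apply n

/-- `resGal (rangeToResGal n) = n` in `Γ_K`. [folklore] -/
@[simp]
theorem resGal_rangeToResGal (n : galRange (K := K) L) :
    resGal (K := K) L (rangeToResGal (K := K) L n) = n :=
  congrArg Subtype.val (resGalToRange_rangeToResGal L n)

/-- Compatibility of the inverse pair `(rangeToResGal, primaryBaseChangeEquiv⁻¹)`. [folklore] -/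
theorem primaryBaseChangeEquiv_symm_smul (n : galRange (K := K) L)
    (Q : geomPrimaryTorsion (W.baseChange L) p) :
    (primaryBaseChangeEquiv L W p).symm (rangeToResGal (K := K) L n • Q) =
      n • (primaryBaseChangeEquiv L W p).symm Q := by
  apply (primaryBaseChangeEquiv L W p).injective
  rw [AddEquiv.apply_symm_apply]
  conv_rhs => rw [← resGalToRange_rangeToResGal L n]
  rw [primaryBaseChangeEquiv_smul, AddEquiv.apply_symm_apply]

/-- **The subgroup model of `H¹(L, E_L[p^∞])`**: for `L/K` algebraic,
`H¹(Γ_L, E_L[p^∞]) ≃ H¹(galRange L, E[p^∞])`, the maps of the mutually inverse compatible pairs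
`(rangeToResGal, primaryBaseChangeEquiv⁻¹)` and `(resGalToRange, primaryBaseChangeEquiv)`.
Serre, *Galois Cohomology*, I.§2.4, II.§1.1. [folklore] -/
def modelIso : galH1Primary (W.baseChange L) p ≃+ subgroupH1 (galRange (K := K) L) (geomPrimaryTorsion W p) where
  toFun := resH1Hom (rangeToResGal (K := K) L) (primaryBaseChangeEquiv L W p).symm.toAddMonoidHom
    (primaryBaseChangeEquiv_symm_smul L W p)
  invFun := resH1Hom (resGalToRange (K := K) L) (primaryBaseChangeEquiv L W p).toAddMonoidHom
    (primaryBaseChangeEquiv_smul L W p)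
  left_inv x := by
    rw [resH1Hom_resH1Hom]
    have e : resH1Hom ((rangeToResGal (K := K) L).comp (resGalToRange (K := K) L))
        ((primaryBaseChangeEquiv L W p).toAddMonoidHom.comp
          (primaryBaseChangeEquiv L W p).symm.toAddMonoidHom)
        (fun x m ↦ by
          simp only [AddMonoidHom.coe_comp, Function.comp_apply, AddEquiv.coe_toAddMonoidHom,
            ContinuousMonoidHom.comp_toFun, primaryBaseChangeEquiv_symm_smul,
            primaryBaseChangeEquiv_smul]) =
          resH1Hom (ContinuousMonoidHom.id _) (AddMonoidHom.id _) (fun _ _ ↦ rfl) :=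
      resH1Hom_congr (by ext σ; exact rangeToResGal_resGalToRange L σ)
        (by ext Q; exact congrArg Subtype.val ((primaryBaseChangeEquiv L W p).apply_symm_apply Q)) _ _
    rw [e, resH1Hom_id]
    rfl
  right_inv x := by
    rw [resH1Hom_resH1Hom]
    have e : resH1Hom ((resGalToRange (K := K) L).comp (rangeToResGal (K := K) L))
        ((primaryBaseChangeEquiv L W p).symm.toAddMonoidHom.comp
          (primaryBaseChangeEquiv L W p).toAddMonoidHom)
        (fun x m ↦ by
          simp only [AddMonoidHom.coe_comp, Function.comp_apply, AddEquiv.coe_toAddMonoidHom,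
            ContinuousMonoidHom.comp_toFun, primaryBaseChangeEquiv_symm_smul,
            primaryBaseChangeEquiv_smul]) =
          resH1Hom (ContinuousMonoidHom.id _) (AddMonoidHom.id _) (fun _ _ ↦ rfl) :=
      resH1Hom_congr (by ext n; exact congrArg Subtype.val (resGalToRange_rangeToResGal L n))
        (by ext P; exact congrArg Subtype.val ((primaryBaseChangeEquiv L W p).symm_apply_apply P)) _ _
    rw [e, resH1Hom_id]
    rfl
  map_add' := map_add _

/-- `modelIso` as a function. [folklore] -/
theorem modelIso_apply (x : galH1Primary (W.baseChange L) p) :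
    modelIso L W p x = resH1Hom (rangeToResGal (K := K) L)
      (primaryBaseChangeEquiv L W p).symm.toAddMonoidHom (primaryBaseChangeEquiv_symm_smul L W p) x :=
  rfl

/-- **Under the subgroup model, `resPrimary` is the restriction to the subgroup `galRange L`**
(the pair `(galRange L ↪ Γ_K, id)`; `Literature.NumberTheory.EllipticCurves.subgroupIncl`).
Serre, *Galois Cohomology*, I.§2.4. [folklore] -/
theorem modelIso_resPrimary (x : galH1Primary W p) :
    modelIso L W p (resPrimary W L p x) =
      resH1Hom (subgroupIncl (galRange (K := K) L)) (AddMonoidHom.id (geomPrimaryTorsion W p))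
        (fun _ _ ↦ rfl) x := by
  rw [modelIso_apply, resPrimary, resH1Hom_resH1Hom]
  exact congrFun (congrArg DFunLike.coe (resH1Hom_congr
    (by ext n; exact congrArg Subtype.val (resGalToRange_rangeToResGal L n))
    (by ext P; exact congrArg Subtype.val ((primaryBaseChangeEquiv L W p).symm_apply_apply P)) _ _)) x

end Model

/-! ## Index `2`: the non-trivial coset -/

section IndexTwo

variable {K : Type u} [Field K] [NumberField K] (L : Type u) [Field L] [NumberField L] [Algebra K L]

/-- `Γ_{L̃} ≤ galRange L` (`galSubgroupClosure_le_range_resGal`). [folklore] -/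
theorem galSubgroupClosure_le_galRange : galSubgroupClosure (K := K) L ≤ galRange (K := K) L :=
  galSubgroupClosure_le_range_resGal L

/-- `galRange L` is open in `Γ_K` (it contains the open subgroup `Γ_{L̃}`). [folklore] -/
theorem isOpen_galRange : IsOpen (galRange (K := K) L : Set (Field.absoluteGaloisGroup K)) :=
  Subgroup.isOpen_mono (galSubgroupClosure_le_galRange L) (isOpen_galSubgroupClosure L)

/-- The copy `j : L → K̄` of `L` inside `K̄` cut out by the chosen embedding:
`j = e⁻¹ ∘ (L → L̄)` with `e : K̄ ≃ L̄`. [folklore] -/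
def embIntoClosure : L →ₐ[K] AlgebraicClosure K :=
  ((algEquivOfEmb L (closureEmb (K := K) L)).symm : AlgebraicClosure L →ₐ[K] AlgebraicClosure K).comp
    (IsScalarTower.toAlgHom K L (AlgebraicClosure L))

/-- `e (j x) = x` in `L̄`. [folklore] -/
@[simp]
theorem algEquivOfEmb_embIntoClosure (x : L) :
    algEquivOfEmb L (closureEmb (K := K) L) (embIntoClosure (K := K) L x) =
      algebraMap L (AlgebraicClosure L) x :=
  (algEquivOfEmb L (closureEmb (K := K) L)).apply_symm_apply _

/-- Elements of `galRange L` fix the copy `j(L)` of `L` pointwise. [folklore] -/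
theorem smul_embIntoClosure_of_mem_galRange {g : Field.absoluteGaloisGroup K}
    (hg : g ∈ galRange (K := K) L) (x : L) :
    (show AlgebraicClosure K ≃ₐ[K] AlgebraicClosure K from g) (embIntoClosure (K := K) L x) =
      embIntoClosure (K := K) L x := by
  obtain ⟨σ, rfl⟩ := hg
  apply (algEquivOfEmb L (closureEmb (K := K) L)).injective
  change algEquivOfEmb L (closureEmb (K := K) L)
      ((show AlgebraicClosure K ≃ₐ[K] AlgebraicClosure K from resGal (K := K) L σ) _) = _
  rw [algEquivOfEmb_resGal_apply, algEquivOfEmb_embIntoClosure, AlgEquiv.commutes]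

/-- **The transported lift of `σ₀ ∈ Aut(L/K)` to `Γ_K`**: lift `σ₀` to a ring automorphism of
`L̄` (`liftAut`, file `SelmerGaloisAction`), view it as a `K`-algebra automorphism
(`IsLiftOfAut.algEquiv`) and transport it to `K̄` through `e : K̄ ≃ L̄`:
`liftToAbsGal L σ₀ = e⁻¹ ∘ σ̃₀ ∘ e`. (Gross 1991, §5: "`τ` is complex conjugation, which lifts
…".) [folklore] -/
def liftToAbsGal (σ₀ : L ≃ₐ[K] L) : Field.absoluteGaloisGroup K :=
  show AlgebraicClosure K ≃ₐ[K] AlgebraicClosure K from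
    ((algEquivOfEmb L (closureEmb (K := K) L)).trans (isLiftOfAut_liftAut σ₀).algEquiv).trans
      (algEquivOfEmb L (closureEmb (K := K) L)).symm

/-- `e (liftToAbsGal σ₀ z) = σ̃₀ (e z)`. [folklore] -/
theorem algEquivOfEmb_liftToAbsGal_apply (σ₀ : L ≃ₐ[K] L) (z : AlgebraicClosure K) :
    algEquivOfEmb L (closureEmb (K := K) L)
        ((show AlgebraicClosure K ≃ₐ[K] AlgebraicClosure K from liftToAbsGal (K := K) L σ₀) z) =
      liftAut σ₀ (algEquivOfEmb L (closureEmb (K := K) L) z) :=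
  (algEquivOfEmb L (closureEmb (K := K) L)).apply_symm_apply _

/-- The transported lift acts on the copy of `L` as `σ₀`: `liftToAbsGal σ₀ (j x) = j (σ₀ x)`.
[folklore] -/
theorem liftToAbsGal_embIntoClosure (σ₀ : L ≃ₐ[K] L) (x : L) :
    (show AlgebraicClosure K ≃ₐ[K] AlgebraicClosure K from liftToAbsGal (K := K) L σ₀)
        (embIntoClosure (K := K) L x) = embIntoClosure (K := K) L (σ₀ x) := by
  apply (algEquivOfEmb L (closureEmb (K := K) L)).injective
  rw [algEquivOfEmb_liftToAbsGal_apply, algEquivOfEmb_embIntoClosure, algEquivOfEmb_embIntoClosure]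
  exact isLiftOfAut_liftAut σ₀ x

/-- A non-trivial `σ₀` gives an element outside `galRange L`. [folklore] -/
theorem liftToAbsGal_not_mem {σ₀ : L ≃ₐ[K] L} (hσ₀ : σ₀ ≠ 1) :
    liftToAbsGal (K := K) L σ₀ ∉ galRange (K := K) L := by
  intro hmem
  apply hσ₀
  ext x
  have h := smul_embIntoClosure_of_mem_galRange L hmem x
  rw [liftToAbsGal_embIntoClosure] at h
  exact (embIntoClosure (K := K) L).injective h

variable [IsGalois K L]

/-- For `L/K` Galois of degree `2`, `galRange L` has index `2` in `Γ_K`: it contains `Γ_{L̃}`,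
of index `[L̃ : K] = [L : K] = 2` (`index_galSubgroupClosure_eq_finrank_of_isGalois`), and is
proper (`liftToAbsGal_not_mem`). [folklore] -/
theorem index_galRange (h2 : Module.finrank K L = 2) {σ₀ : L ≃ₐ[K] L} (hσ₀ : σ₀ ≠ 1) :
    (galRange (K := K) L).index = 2 := by
  have hidx : (galSubgroupClosure (K := K) L).index = 2 := by
    rw [index_galSubgroupClosure_eq_finrank_of_isGalois L, h2]
  have hdvd : (galRange (K := K) L).index ∣ 2 :=
    hidx ▸ Subgroup.index_dvd_of_le (galSubgroupClosure_le_galRange (K := K) L)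
  have hne : (galRange (K := K) L).index ≠ 1 := by
    rw [Ne, Subgroup.index_eq_one]
    intro htop
    exact liftToAbsGal_not_mem L hσ₀ (htop ▸ Subgroup.mem_top _)
  rcases (Nat.dvd_prime Nat.prime_two).mp hdvd with h | h
  · exact absurd h hne
  · exact h

/-- For `L/K` Galois of degree `2`, `galRange L` is normal in `Γ_K`. [folklore] -/
theorem normal_galRange (h2 : Module.finrank K L = 2) {σ₀ : L ≃ₐ[K] L} (hσ₀ : σ₀ ≠ 1) :
    (galRange (K := K) L).Normal :=
  Subgroup.normal_of_index_eq_two (index_galRange L h2 hσ₀)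

/-- **`Γ_K = galRange L ⊔ galRange L · c`** with `c = liftToAbsGal σ₀`, for `L/K` Galois of
degree `2` and `σ₀ ≠ 1`: every `b ∈ Γ_K` satisfies exactly one of `b c⁻¹ ∈ galRange L`,
`b ∈ galRange L`. [folklore] -/
theorem xor_galRange (h2 : Module.finrank K L = 2) {σ₀ : L ≃ₐ[K] L} (hσ₀ : σ₀ ≠ 1)
    (b : Field.absoluteGaloisGroup K) :
    Xor (b * (liftToAbsGal (K := K) L σ₀)⁻¹ ∈ galRange (K := K) L) (b ∈ galRange (K := K) L) := by
  set N := galRange (K := K) L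
  set c := liftToAbsGal (K := K) L σ₀
  have hc : c ∉ N := liftToAbsGal_not_mem L hσ₀
  obtain ⟨a, ha⟩ := Subgroup.index_eq_two_iff.mp (index_galRange L h2 hσ₀)
  by_cases hb : b ∈ N
  · refine Or.inr ⟨hb, fun h ↦ hc ?_⟩
    have := N.mul_mem (N.inv_mem h) hb
    rwa [mul_inv_rev, inv_inv, inv_mul_cancel_right] at this
  · refine Or.inl ⟨?_, hb⟩
    have hba : b * a ∈ N := by
      rcases ha b with ⟨h1, -⟩ | ⟨h1, -⟩
      · exact h1
      · exact absurd h1 hb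
    have hca : c * a ∈ N := by
      rcases ha c with ⟨h1, -⟩ | ⟨h1, -⟩
      · exact h1
      · exact absurd h1 hc
    have := N.mul_mem hba (N.inv_mem hca)
    rwa [mul_inv_rev, mul_assoc, mul_inv_cancel_left] at this

end IndexTwo

end Literature.NumberTheory.EllipticCurves
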